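import Summits.AtomisticToContinuum.BoseEinsteinCondensation.Theorems.BECThomsonPrincipleGDTransferSeededTransportDefs
import Summits.AtomisticToContinuum.BoseEinsteinCondensation.Theorems.BECThomsonPrincipleGDTransferSeededLocalConstancy

/-!
# Route `BECThomsonPrinciple`, crux `GDTransfer` (stmt-AtomisticToContinuum-9482), line `seeded-continuity`
# (skeleton v6) — registered stub `stub_localConstancyBdd`: local constancy of the law of near-minimisers in the
# side, for BOUNDED MEASURABLE admissible profiles, given the measurable transport `ScaledCloseBdd`

Supports (does not close) stmt-AtomisticToContinuum-9482.

**Statement** (`Sig.stub_localConstancyBdd = ScaledCloseBdd → CountLaw → ∀ v, IsRepulsiveFiniteRange v →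
IsBoundedProfile v → LocalConstancy v`).  At fixed particle number `N = m + 1` and every side `L₁ > 0` the
periodic ground-state energy is finite, and for every `ε > 0` there are a radius `r > 0` and a slack `δ₁ > 0`
such that for every side `L'` with `|L' − L₁| < r` some slack `δ' > 0` makes the condensed-side mass
`hiMass = P(n̂₀ ≥ (1−β)N)` of every `δ'`-near-minimiser at `L'` and of every `δ₁`-near-minimiser at `L₁` agree
within `ε`.

**Proof** (c1's `stub_localConstancy`, p138765, with the uniform closeness `vb_scaledPotential_close` of the
finite-continuous class replaced by the hypothesis `ScaledCloseBdd` on kinetic-bounded states).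
* Symmetrise the profile, `u r = v|r|` (same energies; measurable, of range `R₀`, and bounded on all of `ℝ` by
  the `IsBoundedProfile` bound at `|r| ≥ 0`); `E₀ = E₀(u, N, L₁) < ∞` is
  `periodicGroundStateEnergy_ne_top_of_bounded`.
* LAW STABILITY at `(N, L₁)`: `hiMass_toReal_close_of_nearMinimisers` (proved in tree for measurable bounded
  finite-range profiles, from `CountLaw`) gives a tolerance `δ`; pick a real `δ' > 0` below it and put
  `η = δ'/4`.
* KINETIC A-PRIORI BOUNDS: `ScaledCloseBdd` at the finite budgets `K₀ = E₀ + η` and `K₁ = E₀ + 3η` with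
  tolerance `η` gives `ϑ₁, ϑ₂ > 0`.  For `|b − 1| < ϑ₁` an `η`-near-minimiser `Ξ` of `u` at `L₁` has kinetic
  energy `T(Ξ) ≤ E_u(Ξ) ≤ K₀`, so `E₀(b⁻²u(·/b), L₁) ≤ E_{b⁻²u(·/b)}(Ξ) ≤ E_u(Ξ) + η ≤ E₀ + 2η`.
* TRANSPORT: for `|L' − L₁| < r = min(L₁/2, ϑL₁/2)`, `ϑ = min ϑ₁ ϑ₂`, put `b = L₁/L'` (`|b − 1| < ϑ`) and
  dilate, `Φ = Ψ'_b` (`PeriodicTrialState.dilate`): `hiMass Φ = hiMass Ψ'` (`hiMass_dilate`) and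
  `E_{b⁻²u(·/b)}(Φ) = b⁻²E_u(Ψ') ≤ E₀(b⁻²u(·/b), L₁) + η` for a `b²η`-near-minimiser `Ψ'` at `L'`
  (`periodicEnergy_dilate`, `periodicGroundStateEnergy_scaledPotential`); hence
  `T(Φ) ≤ E_{b⁻²u(·/b)}(Φ) ≤ E₀ + 3η = K₁`, so `E_u(Φ) ≤ E_{b⁻²u(·/b)}(Φ) + η ≤ E₀ + 4η = E₀ + δ' ≤ E₀ + δ`:
  `Φ` is a `δ`-near-minimiser of `u` at `L₁`, and with `δ₁ = δ'` law stability applies to `(Φ, Ψ₁)`.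

## References

* [LSSY2005] E. H. Lieb, R. Seiringer, J. P. Solovej, J. Yngvason, *The Mathematics of the Bose Gas and
  its Condensation*, Birkhäuser (2005): Ch. 5, footnote to (5.3) (scaling of the torus problem); §1.2 (1.16),
  Ch. 2 (2.1) (the admissible class: measurable, finite range).
* [ReedSimonIV1978] M. Reed, B. Simon, *Methods of Modern Mathematical Physics IV*, Academic Press (1978),
  Thm XIII.1 and §XIII.12 (nondegenerate ground states).
-/

noncomputable section

open MeasureTheory Filter Set Metric
open scoped ENNReal NNReal

namespace Summit.AtomisticToContinuum.BoseEinsteinCondensation.Cruxes.GDTransfer.Seeded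

open Literature.MathematicalPhysics.QuantumManyBody.BoseGas
open Literature.Barriers.AtomisticToContinuum.BoseGas (scaledPotential periodicEnergy_dilate
  periodicGroundStateEnergy_scaledPotential)

/-- The kinetic energy is at most the total energy (`lintegral_kineticDensity_le_periodicEnergy` of
`Literature/…/PeriodicKineticBudget.lean`, inlined to keep the import list short). [folklore] -/
private theorem kinetic_le_periodicEnergy {N : ℕ} {L : ℝ} (v : ℝ → ℝ≥0∞)
    (Ψ : PeriodicTrialState N L) :
    (∫⁻ X in cellN N L, kineticDensity Ψ.ψ X) ≤ periodicEnergy v Ψ :=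
  lintegral_mono fun _ => le_self_add

/-! ## The stub -/

/-- **Registered stub `stub_localConstancyBdd`** (line `seeded-continuity`, skeleton v6, of crux `GDTransfer`,
stmt-AtomisticToContinuum-9482): local constancy in the side `L` of the condensed-side mass of the
near-minimisers, for bounded measurable repulsive finite-range profiles, given the count law and the measurable
transport `ScaledCloseBdd` (closeness of the energies of `u` and `b⁻²u(·/b)` on kinetic-bounded states).
Dilation transport (`PeriodicTrialState.dilate`, `hiMass_dilate`) with the a-priori kinetic bounds
`T ≤ E ≤ E₀ + η`, `≤ E₀ + 3η` of near-minimisers + near-minimiser law stability at `(N, L₁)`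
(`hiMass_toReal_close_of_nearMinimisers`). [cite: LSSY2005, Ch. 5, footnote to (5.3)] -/
theorem stub_localConstancyBdd : Sig.stub_localConstancyBdd := by
  intro hS hC v hv hbd m β L₁ hL₁
  obtain ⟨hmeas, R₀, hR₀⟩ := hv
  obtain ⟨B, hB⟩ := hbd
  -- the symmetrised profile `u r = v |r|`: same energies, bounded on all of `ℝ`
  set u : ℝ → ℝ≥0∞ := fun r => v |r| with hu
  have hu_meas : Measurable u := hmeas.comp continuous_abs.measurable
  have huR : ∀ r, R₀ < r → u r = 0 := fun r hr => hR₀ _ (hr.trans_le (le_abs_self r))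
  have huB : ∀ r, u r ≤ ENNReal.ofReal B := fun r => hB |r| (abs_nonneg r)
  have huM : ∀ r, u r ≤ (B.toNNReal : ℝ≥0∞) := huB
  have hE : ∀ {L : ℝ} (Φ : PeriodicTrialState (m + 1) L), periodicEnergy u Φ = periodicEnergy v Φ := by
    intro L Φ
    unfold periodicEnergy periodicInteraction periodizedPotential
    simp only [hu, abs_norm]
  have hE₀ : ∀ L : ℝ, periodicGroundStateEnergy u (m + 1) L = periodicGroundStateEnergy v (m + 1) L :=
    fun L => by
    unfold periodicGroundStateEnergy
    exact iInf_congr fun Φ => hE Φ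
  have hE₀fin : periodicGroundStateEnergy u (m + 1) L₁ ≠ ⊤ :=
    periodicGroundStateEnergy_ne_top_of_bounded hu_meas huR huM m hL₁
  refine ⟨?_, fun ε hε => ?_⟩
  · -- the ground-state energy is finite
    rw [← hE₀]
    exact hE₀fin
  -- law stability at `(N, L₁)` for `u`, tolerance `δ`, and a real `δ' > 0` below it
  obtain ⟨δ, hδ0, hδ⟩ := hiMass_toReal_close_of_nearMinimisers hC hu_meas huR huM m hL₁ β hε
  obtain ⟨δ', hδ'0, hδ'⟩ : ∃ δ' : ℝ, 0 < δ' ∧ ENNReal.ofReal δ' ≤ δ := by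
    obtain ⟨q, _, hq1, hq2⟩ := ENNReal.lt_iff_exists_real_btwn.1 hδ0
    exact ⟨q, ENNReal.ofReal_pos.1 hq1, hq2.le⟩
  -- the quarter slack `η = δ'/4`
  set η : ℝ := δ' / 4 with hη
  have hη0 : 0 < η := by positivity
  have h4η : ENNReal.ofReal η + ENNReal.ofReal η + ENNReal.ofReal η + ENNReal.ofReal η ≤ δ := by
    rw [← ENNReal.ofReal_add hη0.le hη0.le, ← ENNReal.ofReal_add (by positivity) hη0.le,
      ← ENNReal.ofReal_add (by positivity) hη0.le]
    refine le_trans (le_of_eq ?_) hδ'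
    rw [hη]
    ring_nf
  -- the two finite kinetic budgets `K₀ = E₀ + η`, `K₁ = E₀ + 3η` and the corresponding `ϑ₁`, `ϑ₂`
  have hK₀ : periodicGroundStateEnergy u (m + 1) L₁ + ENNReal.ofReal η ≠ ⊤ :=
    ENNReal.add_ne_top.2 ⟨hE₀fin, ENNReal.ofReal_ne_top⟩
  have hK₁ : periodicGroundStateEnergy u (m + 1) L₁ + ENNReal.ofReal η + ENNReal.ofReal η +
      ENNReal.ofReal η ≠ ⊤ :=
    ENNReal.add_ne_top.2 ⟨ENNReal.add_ne_top.2 ⟨hK₀, ENNReal.ofReal_ne_top⟩, ENNReal.ofReal_ne_top⟩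
  obtain ⟨ϑ₁, hϑ₁0, hϑ₁⟩ := hS u hu_meas B huB R₀ huR m L₁ hL₁ _ hK₀ η hη0
  obtain ⟨ϑ₂, hϑ₂0, hϑ₂⟩ := hS u hu_meas B huB R₀ huR m L₁ hL₁ _ hK₁ η hη0
  set ϑ : ℝ := min ϑ₁ ϑ₂ with hϑ
  have hϑ0 : 0 < ϑ := lt_min hϑ₁0 hϑ₂0
  -- the radius and the slack at `L₁`
  refine ⟨min (L₁ / 2) (ϑ * L₁ / 2), by positivity, ENNReal.ofReal δ', ENNReal.ofReal_pos.2 hδ'0,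
    fun L' hL' => ?_⟩
  have hr1 : |L' - L₁| < L₁ / 2 := hL'.trans_le (min_le_left _ _)
  have hr2 : |L' - L₁| < ϑ * L₁ / 2 := hL'.trans_le (min_le_right _ _)
  have hL'ge : L₁ / 2 < L' := by linarith [(abs_lt.1 hr1).1]
  have hL'pos : 0 < L' := by linarith
  set b : ℝ := L₁ / L' with hb
  have hb0 : 0 < b := div_pos hL₁ hL'pos
  have hbL : L₁ = b * L' := by rw [hb, div_mul_cancel₀ _ hL'pos.ne']
  have hb1 : |b - 1| < ϑ := by
    rw [hb, show L₁ / L' - 1 = (L₁ - L') / L' by field_simp, abs_div, abs_of_pos hL'pos,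
      div_lt_iff₀ hL'pos, abs_sub_comm]
    calc |L' - L₁| < ϑ * L₁ / 2 := hr2
      _ = ϑ * (L₁ / 2) := by ring
      _ ≤ ϑ * L' := by gcongr
  have hb1₁ : |b - 1| < ϑ₁ := hb1.trans_le (min_le_left _ _)
  have hb1₂ : |b - 1| < ϑ₂ := hb1.trans_le (min_le_right _ _)
  have hb2 : ENNReal.ofReal (b ^ 2) ≠ 0 := by simpa using hb0.ne'
  -- the slack at `L'`: `b² η`
  refine ⟨ENNReal.ofReal (b ^ 2) * ENNReal.ofReal η,
    ENNReal.mul_pos hb2 (ENNReal.ofReal_pos.2 hη0).ne', fun Ψ' Ψ₁ hΨ' hΨ₁ => ?_⟩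
  -- the dilated state: same `hiMass`, near-minimiser of the scaled potential at side `L₁`
  set Φ : PeriodicTrialState (m + 1) L₁ := Ψ'.dilate b hb0 hbL with hΦ
  have hmass : hiMass m L₁ β Φ.ψ = hiMass m L' β Ψ'.ψ := hiMass_dilate hb0 hbL β Ψ'
  have hGS : periodicGroundStateEnergy (scaledPotential u b) (m + 1) L₁ =
      (ENNReal.ofReal (b ^ 2))⁻¹ * periodicGroundStateEnergy u (m + 1) L' := by
    have h := periodicGroundStateEnergy_scaledPotential (M := L') hb0 u (m + 1)
    rwa [← hbL] at h
  have hΦsc : periodicEnergy (scaledPotential u b) Φ ≤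
      periodicGroundStateEnergy (scaledPotential u b) (m + 1) L₁ + ENNReal.ofReal η := by
    rw [hΦ, periodicEnergy_dilate hb0 hbL u Ψ', hGS, hE Ψ', hE₀ L']
    calc (ENNReal.ofReal (b ^ 2))⁻¹ * periodicEnergy v Ψ'
        ≤ (ENNReal.ofReal (b ^ 2))⁻¹ * (periodicGroundStateEnergy v (m + 1) L' +
            ENNReal.ofReal (b ^ 2) * ENNReal.ofReal η) := by gcongr
      _ = (ENNReal.ofReal (b ^ 2))⁻¹ * periodicGroundStateEnergy v (m + 1) L' + ENNReal.ofReal η := by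
          rw [mul_add, ← mul_assoc, ENNReal.inv_mul_cancel hb2 ENNReal.ofReal_ne_top, one_mul]
  -- (a) the ground-state energy of the scaled profile at side `L₁` exceeds `E₀` by at most `2η`:
  -- test an `η`-near-minimiser `Ξ` of `u` (kinetic energy `≤ E_u(Ξ) ≤ E₀ + η = K₀`) against `ScaledCloseBdd`
  have hE0b : periodicGroundStateEnergy (scaledPotential u b) (m + 1) L₁ ≤
      periodicGroundStateEnergy u (m + 1) L₁ + ENNReal.ofReal η + ENNReal.ofReal η := by
    have hlt : periodicGroundStateEnergy u (m + 1) L₁ <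
        periodicGroundStateEnergy u (m + 1) L₁ + ENNReal.ofReal η :=
      ENNReal.lt_add_right hE₀fin (ENNReal.ofReal_pos.2 hη0).ne'
    obtain ⟨Ξ, hΞ⟩ := iInf_lt_iff.1 hlt
    have hT : (∫⁻ X in cellN (m + 1) L₁, kineticDensity Ξ.ψ X) ≤
        periodicGroundStateEnergy u (m + 1) L₁ + ENNReal.ofReal η :=
      (kinetic_le_periodicEnergy u Ξ).trans hΞ.le
    calc periodicGroundStateEnergy (scaledPotential u b) (m + 1) L₁
        ≤ periodicEnergy (scaledPotential u b) Ξ := periodicGroundStateEnergy_le _ Ξ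
      _ ≤ periodicEnergy u Ξ + ENNReal.ofReal η := (hϑ₁ b hb1₁ Ξ hT).2
      _ ≤ periodicGroundStateEnergy u (m + 1) L₁ + ENNReal.ofReal η + ENNReal.ofReal η :=
          add_le_add hΞ.le le_rfl
  -- (b) the a-priori kinetic bound of the dilated near-minimiser: `T(Φ) ≤ E_{u_b}(Φ) ≤ E₀ + 3η = K₁`
  have hTΦ : (∫⁻ X in cellN (m + 1) L₁, kineticDensity Φ.ψ X) ≤
      periodicGroundStateEnergy u (m + 1) L₁ + ENNReal.ofReal η + ENNReal.ofReal η + ENNReal.ofReal η :=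
    calc (∫⁻ X in cellN (m + 1) L₁, kineticDensity Φ.ψ X)
        ≤ periodicEnergy (scaledPotential u b) Φ := kinetic_le_periodicEnergy _ Φ
      _ ≤ periodicGroundStateEnergy (scaledPotential u b) (m + 1) L₁ + ENNReal.ofReal η := hΦsc
      _ ≤ periodicGroundStateEnergy u (m + 1) L₁ + ENNReal.ofReal η + ENNReal.ofReal η +
            ENNReal.ofReal η := add_le_add hE0b le_rfl
  -- so `Φ` and `Ψ₁` are `δ`-near-minimisers of `u` at `(N, L₁)`
  have hΦnear : periodicEnergy u Φ ≤ periodicGroundStateEnergy u (m + 1) L₁ + δ :=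
    calc periodicEnergy u Φ
        ≤ periodicEnergy (scaledPotential u b) Φ + ENNReal.ofReal η := (hϑ₂ b hb1₂ Φ hTΦ).1
      _ ≤ periodicGroundStateEnergy (scaledPotential u b) (m + 1) L₁ + ENNReal.ofReal η +
            ENNReal.ofReal η := add_le_add hΦsc le_rfl
      _ ≤ periodicGroundStateEnergy u (m + 1) L₁ + ENNReal.ofReal η + ENNReal.ofReal η +
            ENNReal.ofReal η + ENNReal.ofReal η := add_le_add (add_le_add hE0b le_rfl) le_rfl
      _ = periodicGroundStateEnergy u (m + 1) L₁ + (ENNReal.ofReal η + ENNReal.ofReal η +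
            ENNReal.ofReal η + ENNReal.ofReal η) := by simp only [add_assoc]
      _ ≤ periodicGroundStateEnergy u (m + 1) L₁ + δ := add_le_add le_rfl h4η
  have hΨ₁near : periodicEnergy u Ψ₁ ≤ periodicGroundStateEnergy u (m + 1) L₁ + δ := by
    rw [hE, hE₀]
    exact hΨ₁.trans (add_le_add le_rfl hδ')
  have h := hδ Φ Ψ₁ hΦnear hΨ₁near
  rwa [hmass] at h

end Summit.AtomisticToContinuum.BoseEinsteinCondensation.Cruxes.GDTransfer.Seeded

end
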